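import Literature.MathematicalPhysics.QuantumManyBody.BosonicFloor

/-!
# Route `BECSwapNoCatastrophe` — support item `SwapToZeroMode` (stmt-AtomisticToContinuum-14397):
non-negative near-minimisers of the periodic energy exist at every slack

Helper file for `Summit.AtomisticToContinuum.BoseEinsteinCondensation.Theses.BECSwapNoCatastrophe.SwapToZeroMode`
(step (1) of the planner's sketch). For a measurable pair potential `v ≥ 0` (hard cores allowed),
every `δ > 0` and every inhabited class `PeriodicTrialState M L`, there is a periodic trial state
`Φ` with `Φ ≥ 0` pointwise (`Φ.ψ X = |Φ.ψ X|`) and `⟨Φ, HΦ⟩ ≤ E^per(M, L) + δ`.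

Proof (diamagnetic smoothing, with the tree's `BosonicFloor` toolkit): take a `δ/2`-near-minimiser
`Ψ` (any state if `E^per = ⊤`), put `F = ∑_σ |Ψ ∘ σ|²` and `g_ε = √(ε² + F) − ε ≥ 0` (`C¹`, periodic,
symmetric: `contDiff_sqrtSym`, `sqrtSym_add_single`, `sqrtSym_comp_perm`); the convexity inequality for
gradients and `g_ε² ≤ F` give `𝓔[g_ε] ≤ M! 𝓔[Ψ]` (`lintegral_energyDensity_sqrtSym_le`), while
`‖g_ε‖² → M!` as `ε = 1/(k+1) → 0` (`tendsto_lintegral_nnnorm_sqrtSym_sq`); for `k` large the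
normalised `g_ε/‖g_ε‖` has energy `≤ M! 𝓔[Ψ]/‖g_ε‖² ≤ E^per + δ`.
-/

noncomputable section

namespace Summit.AtomisticToContinuum.BoseEinsteinCondensation.Theorems

open MeasureTheory Filter Topology
open scoped ENNReal NNReal
open Literature.MathematicalPhysics.QuantumManyBody.BoseGas

namespace SwapToZeroMode

variable {M : ℕ} {L : ℝ}

/-- **Non-negative near-minimisers exist at every slack** (periodic box, any measurable `v ≥ 0`,
hard cores included): for `δ > 0` there is a periodic trial state `Φ ≥ 0` (`Φ.ψ X = |Φ.ψ X|` for all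
`X`) with `⟨Φ, HΦ⟩ ≤ E^per(M, L) + δ` — the regularised modulus `√(ε² + ∑_σ|Ψ∘σ|²) − ε` of a
`δ/2`-near-minimiser `Ψ`, normalised, for `ε` small (convexity inequality for gradients).
[cite: LiebLoss2001, Thm. 7.8] -/
theorem exists_nonneg_nearMinimiser {v : ℝ → ℝ≥0∞} (hv : Measurable v)
    (Ψ₀ : PeriodicTrialState M L) {δ : ℝ≥0∞} (hδ : 0 < δ) :
    ∃ Φ : PeriodicTrialState M L,
      periodicEnergy v Φ ≤ periodicGroundStateEnergy v M L + δ ∧ ∀ X, Φ.ψ X = (‖Φ.ψ X‖ : ℂ) := by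
  set E₀ := periodicGroundStateEnergy v M L with hE₀
  -- a `δ/2`-near-minimiser
  obtain ⟨Ψ, hΨ⟩ : ∃ Ψ : PeriodicTrialState M L, periodicEnergy v Ψ ≤ E₀ + δ / 2 := by
    by_cases htop : E₀ = ⊤
    · exact ⟨Ψ₀, by rw [htop, top_add]; exact le_top⟩
    · have hlt : E₀ < E₀ + δ / 2 := ENNReal.lt_add_right htop (ENNReal.half_pos hδ.ne').ne'
      obtain ⟨Ψ, hΨ⟩ := iInf_lt_iff.1 hlt
      exact ⟨Ψ, hΨ.le⟩
  set f : Config M → ℂ := Ψ.ψ with hf_def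
  set cM : ℝ≥0∞ := (Fintype.card (Equiv.Perm (Fin M)) : ℝ≥0∞) with hcM_def
  have hcM0 : cM ≠ 0 := Nat.cast_ne_zero.2 Fintype.card_ne_zero
  have hcMtop : cM ≠ ⊤ := ENNReal.natCast_ne_top _
  -- the regularised symmetrised modulus `g_k`, `ε = 1/(k+1)`
  set g : ℕ → Config M → ℂ := fun k X =>
    ((Real.sqrt ((1 / ((k : ℝ) + 1)) ^ 2 + ∑ σ : Equiv.Perm (Fin M), ‖f (X ∘ σ)‖ ^ 2) -
      (1 / ((k : ℝ) + 1)) : ℝ) : ℂ) with hg_def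
  set u : ℕ → ℝ≥0∞ := fun k => ∫⁻ X in cellN M L, (‖g k X‖₊ : ℝ≥0∞) ^ 2 with hu_def
  have htop1 : ∫⁻ X in cellN M L, (‖f X‖₊ : ℝ≥0∞) ^ 2 ≠ ⊤ := by
    rw [hf_def, Ψ.norm_eq]; exact ENNReal.one_ne_top
  have hlim : Tendsto u atTop (𝓝 cM) := by
    have h := tendsto_lintegral_nnnorm_sqrtSym_sq (L := L) Ψ.contDiff htop1
    rw [Ψ.norm_eq, mul_one] at h
    exact h
  have hEg : ∀ k, ∫⁻ X in cellN M L, (kineticDensity (g k) X +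
      periodicInteraction v L X * (‖g k X‖₊ : ℝ≥0∞) ^ 2) ≤ cM * periodicEnergy v Ψ :=
    fun k => lintegral_energyDensity_sqrtSym_le hv Ψ.contDiff Nat.one_div_pos_of_nat
  -- choose the regularisation parameter
  obtain ⟨k, hk0, hk⟩ : ∃ k, u k ≠ 0 ∧ cM * periodicEnergy v Ψ ≤ (E₀ + δ) * u k := by
    have hev0 : ∀ᶠ k in atTop, 0 < u k := hlim.eventually (lt_mem_nhds (pos_iff_ne_zero.2 hcM0))
    by_cases htop : E₀ + δ = ⊤
    · obtain ⟨k, hk⟩ := hev0.exists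
      exact ⟨k, hk.ne', by rw [htop, ENNReal.top_mul hk.ne']; exact le_top⟩
    · have hE₀ : E₀ ≠ ⊤ := fun h => htop (by rw [h, top_add])
      have hδtop : δ ≠ ⊤ := fun h => htop (by rw [h, add_top])
      have hlt : cM * periodicEnergy v Ψ < (E₀ + δ) * cM := by
        calc cM * periodicEnergy v Ψ ≤ cM * (E₀ + δ / 2) := by gcongr
          _ = (E₀ + δ / 2) * cM := mul_comm _ _
          _ < (E₀ + δ) * cM :=
              ENNReal.mul_lt_mul_left hcM0 hcMtop
                (ENNReal.add_lt_add_left hE₀ (ENNReal.half_lt_self hδ.ne' hδtop))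
      have hlim2 : Tendsto (fun k => (E₀ + δ) * u k) atTop (𝓝 ((E₀ + δ) * cM)) :=
        ENNReal.Tendsto.const_mul hlim (Or.inl hcM0)
      have hev : ∀ᶠ k in atTop, cM * periodicEnergy v Ψ < (E₀ + δ) * u k :=
        hlim2.eventually (lt_mem_nhds hlt)
      obtain ⟨k, hk1, hk2⟩ := (hev0.and hev).exists
      exact ⟨k, hk1.ne', hk2.le⟩
  -- properties of `g_k`
  have hεk : (0 : ℝ) < 1 / ((k : ℝ) + 1) := Nat.one_div_pos_of_nat
  have hgC : ContDiff ℝ 1 (g k) := contDiff_sqrtSym Ψ.contDiff hεk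
  have hgper : ∀ (X : Config M) (i : Fin M) (kk : Fin 3),
      g k (X + Pi.single i (EuclideanSpace.single kk L)) = g k X :=
    fun X i kk => sqrtSym_add_single Ψ.periodic (1 / ((k : ℝ) + 1)) X i kk
  have hgsymm : ∀ (σ : Equiv.Perm (Fin M)) (X : Config M), g k (X ∘ σ) = g k X :=
    fun σ X => sqrtSym_comp_perm f (1 / ((k : ℝ) + 1)) σ X
  have hutop : u k ≠ ⊤ :=
    ne_top_of_le_ne_top (ENNReal.mul_ne_top hcMtop htop1)
      (lintegral_nnnorm_sqrtSym_sq_le Ψ.contDiff.continuous hεk)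
  -- normalise
  have hmpos : 0 < (u k).toReal := ENNReal.toReal_pos hk0 hutop
  set c : ℝ := Real.sqrt ((u k).toReal)⁻¹ with hc_def
  have hc0 : 0 ≤ c := Real.sqrt_nonneg _
  have hc2 : ENNReal.ofReal (c ^ 2) = (u k)⁻¹ := by
    rw [hc_def, Real.sq_sqrt (inv_nonneg.2 hmpos.le), ENNReal.ofReal_inv_of_pos hmpos,
      ENNReal.ofReal_toReal hutop]
  let Φ : PeriodicTrialState M L :=
    { ψ := fun X => (c : ℂ) * g k X
      contDiff := contDiff_const.mul hgC
      periodic := fun X i kk => by rw [hgper]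
      symm := fun σ X => by rw [hgsymm]
      norm_eq := by
        simp only [ennorm_real_mul_sq c hc0]
        rw [lintegral_const_mul' _ _ ENNReal.ofReal_ne_top, hc2]
        exact ENNReal.inv_mul_cancel hk0 hutop }
  refine ⟨Φ, ?_, fun X => ?_⟩
  · have hE : periodicEnergy v Φ = (u k)⁻¹ * ∫⁻ X in cellN M L,
        (kineticDensity (g k) X + periodicInteraction v L X * (‖g k X‖₊ : ℝ≥0∞) ^ 2) := by
      unfold periodicEnergy
      rw [← hc2, ← lintegral_const_mul' _ _ ENNReal.ofReal_ne_top]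
      refine lintegral_congr fun X => ?_
      change kineticDensity (fun X => (c : ℂ) * g k X) X + periodicInteraction v L X *
        ((‖(c : ℂ) * g k X‖₊ : ℝ≥0∞)) ^ 2 = _
      rw [kineticDensity_const_mul hgC c hc0, ennorm_real_mul_sq c hc0]
      ring
    calc periodicEnergy v Φ ≤ (u k)⁻¹ * (cM * periodicEnergy v Ψ) := by
          rw [hE]; gcongr; exact hEg k
      _ ≤ (u k)⁻¹ * ((E₀ + δ) * u k) := by gcongr
      _ = E₀ + δ := by
          rw [mul_comm (E₀ + δ), ← mul_assoc, ENNReal.inv_mul_cancel hk0 hutop, one_mul]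
  · show (c : ℂ) * g k X = (‖(c : ℂ) * g k X‖ : ℂ)
    have hr : 0 ≤ Real.sqrt ((1 / ((k : ℝ) + 1)) ^ 2 + ∑ σ : Equiv.Perm (Fin M), ‖f (X ∘ σ)‖ ^ 2) -
        1 / ((k : ℝ) + 1) := sqrtReg_nonneg hεk.le (by positivity)
    rw [hg_def, norm_mul, Complex.norm_real, Complex.norm_real, Real.norm_of_nonneg hc0,
      Real.norm_of_nonneg hr]
    push_cast
    ring

end SwapToZeroMode

end Summit.AtomisticToContinuum.BoseEinsteinCondensation.Theorems

end
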